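import Literature.Computability.Cryptography.HallgrenClassGroupBlock
import Literature.Computability.Cryptography.KitaevFamilyUniform
import Literature.Computability.QuantumComplexity.CleanBlockDesc
import Literature.Computability.QuantumComplexity.RevCleanPoly
import Literature.Computability.Cryptography.QuantumCircuitDescFP
import HarnessLib

/-!
# Hallgren 2005 / class numbers under GRH — Kitaev's class-group family is polynomial-time uniform

Topic `Literature/Computability/Cryptography`; proof companion of `HallgrenClassGroupAssembly.lean`
(named fact `Hallgren2005.subgroupOrder_qsolvable`). Definitions and theorems; no named fact. Sequel of
`HallgrenClassGroupBlock.lean` (the block `VC`) and the class-group twin of `ShorDiscreteLogUniform.lean`: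
**the description `1^ℓ ↦ sigmaEncode ⟨ℓ, clNumControls ℓ + mWC ℓ, kitaevCircuit (VC ℓ) (clTypeOf ℓ)⟩`
of Kitaev's class-group family `kitaevClFamily mWC VC` is computable in polynomial time** (Kitaev 1995,
§4, p. 15: "our procedure is uniform, meaning that not only the operation sequence has length
`poly(k+n)` but also it can be constructed in time `poly(k+n)` by a classical Turing machine";
`P`-uniformity, Arora–Barak 2009, Def. 6.12). By `QCircuitFamily.isUniform_iff_descFn_mem_FP` it
suffices to write the description function as an `FP` string function, piece by piece:

* sizes as polynomials (`lenPoly`) and as counter expressions (`TGE`, `LvGE`, `BGE`, `KGE`, `NGE`,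
  `PPGE`, `sWireGE`) in the family index;
* the Hadamard layer on the `clNumControls ℓ` control wires (`hadG`, `render_out_hadG`);
* the clean block — `RevClean.flatMap_opBits_cleanOps_mem_FP` (`CleanBlockDesc.lean`, no suffix) with
  `RevDesc.flatMap_gateEnc_revCompile_toRevList`;
* the phase layer `S³` on the sine-test wires — a two-loop generator `phaseG` over the
  `clTrials ℓ · ℓ · clLevels ℓ` (trial, slot, level) triples and the `B` wires of each sine window,
  with the arithmetic form of the layout `clTypeOf_eq` (`σ = (j / B) mod 2`) and `render_out_phaseG`;
* `descF`, `descF_eq`, and **`kitaevClFamily_isUniform`**.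

## References

* A. Yu. Kitaev, *Quantum measurements and the Abelian Stabilizer Problem*, arXiv:quant-ph/9511026
  (1995), §3 Remark 8 (the sine tests), §4 p. 15 (uniformity) [Kitaev1995].
* S. Arora, B. Barak, *Computational Complexity: A Modern Approach*, CUP 2009, §6.2 Def. 6.12,
  Remark 6.7 (descriptions printed with counters) [AroraBarak2009].
-/

noncomputable section

namespace Literature.Computability.Cryptography.Hallgren2005

namespace ClUniform

open _root_.Computability Polynomial Complexity Complexity.Brick Complexity.Plumb QuantumComplexity
  QuantumComplexity.RevSim QuantumComplexity.RevDesc QuantumComplexity.RevClean Kitaev1995 ClBlockFP ClBlock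

/-! #### Sizes as polynomials and as counter expressions in the family index `u = ℓ` -/

/-- `clTrials` as a polynomial. [folklore] -/
def TP : Polynomial ℕ := C 4 * X ^ 2 + C 4
/-- `clLevels` as a polynomial. [folklore] -/
def LvP : Polynomial ℕ := C 4 * X + C 1
/-- `clNumBlocks` as a polynomial. [folklore] -/
def NBP : Polynomial ℕ := TP * (X * (LvP * C 2))
/-- `clBlockSize` as a polynomial. [folklore] -/
def BP : Polynomial ℕ := C 768 * (NBP + C 1)
/-- `clNumControls` as a polynomial. [folklore] -/
def KP : Polynomial ℕ := TP * (X * (LvP * (C 2 * BP)))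
/-- The total data length `ℓ + clNumControls ℓ` as a polynomial of `ℓ`. [folklore] -/
def lenPoly : Polynomial ℕ := X + KP

/-- `lenPoly` evaluates to the data length. [folklore] -/
theorem lenPoly_eval (ℓ : ℕ) : lenPoly.eval ℓ = ℓ + clNumControls ℓ := by
  simp [lenPoly, KP, BP, NBP, LvP, TP, clNumControls, clTrials, clSlots, clLevels, clBlockSize, clNumBlocks]

/-- The family index `ℓ`. [folklore] -/
def uE : GE := .var .uu
/-- `T = 4ℓ² + 4`. [folklore] -/
def TGE : GE := .add (.mul (.const 4) (.mul uE uE)) (.const 4)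
/-- `Lv = 4ℓ + 1`. [folklore] -/
def LvGE : GE := .add (.mul (.const 4) uE) (.const 1)
/-- The number of blocks. [folklore] -/
def NBGE : GE := .mul TGE (.mul uE (.mul LvGE (.const 2)))
/-- The block length `B`. [folklore] -/
def BGE : GE := .mul (.const 768) (.add NBGE (.const 1))
/-- The number of controls `K`. [folklore] -/
def KGE : GE := .mul TGE (.mul uE (.mul LvGE (.mul (.const 2) BGE)))
/-- The number of data wires `N = ℓ + K`. [folklore] -/
def NGE : GE := .add uE KGE
/-- The number of (trial, slot, level) triples `T · ℓ · Lv`. [folklore] -/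
def PPGE : GE := .mul TGE (.mul uE LvGE)
/-- The wire of repetition `jj` of the sine window of triple `tt`: `ℓ + ((2 tt + 1) B + jj)`. [folklore] -/
def sWireGE : GE := .add uE (.add (.mul (.add (.mul (.const 2) (.var .tt)) (.const 1)) BGE) (.var .jj))

section eval

variable {env : GV → ℕ} {ℓ : ℕ} (hu : env .uu = ℓ)
include hu

/-- Value of `uE`. [folklore] -/
theorem eval_uE : uE.eval env = ℓ := by rw [uE, GExpr.eval, hu]

/-- Value of `TGE`. [folklore] -/
theorem eval_TGE : TGE.eval env = clTrials ℓ := by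
  simp only [TGE, GExpr.eval, eval_uE hu, clTrials, sq]

/-- Value of `LvGE`. [folklore] -/
theorem eval_LvGE : LvGE.eval env = clLevels ℓ := by
  simp only [LvGE, GExpr.eval, eval_uE hu, clLevels]

/-- Value of `BGE`. [folklore] -/
theorem eval_BGE : BGE.eval env = clBlockSize ℓ := by
  simp only [BGE, NBGE, GExpr.eval, eval_uE hu, eval_TGE hu, eval_LvGE hu]; rfl

/-- Value of `KGE`. [folklore] -/
theorem eval_KGE : KGE.eval env = clNumControls ℓ := by
  simp only [KGE, GExpr.eval, eval_uE hu, eval_TGE hu, eval_LvGE hu, eval_BGE hu]; rfl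

/-- Value of `NGE`. [folklore] -/
theorem eval_NGE : NGE.eval env = dataNC ℓ := by
  simp only [NGE, GExpr.eval, eval_uE hu, eval_KGE hu]; rfl

/-- Value of `PPGE`. [folklore] -/
theorem eval_PPGE : PPGE.eval env = clTrials ℓ * (ℓ * clLevels ℓ) := by
  simp only [PPGE, GExpr.eval, eval_uE hu, eval_TGE hu, eval_LvGE hu]

/-- Value of `sWireGE`. [folklore] -/
theorem eval_sWireGE : sWireGE.eval env = ℓ + ((2 * env .tt + 1) * clBlockSize ℓ + env .jj) := by
  simp only [sWireGE, GExpr.eval, eval_uE hu, eval_BGE hu]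

end eval

/-- The environment of the family index. [folklore] -/
theorem envU_uu (ℓ : ℕ) : envU ℓ GV.uu = ℓ := GenProg.initEnv_self _ _

/-- `NGE` mentions only the family index. [folklore] -/
theorem inUU_NGE : InUU NGE := by
  intro x hx
  simpa [NGE, KGE, BGE, NBGE, LvGE, TGE, uE, GExpr.fv] using hx

/-! #### The Hadamard layer -/

/-- **Generator of the Hadamard layer**: an `H` on each control wire `ℓ + j`, `j < K`.
[cite: AroraBarak2009, §6.2 (descriptions printed with counters)] -/
def hadG : GS := .loop .jj KGE (agateG ⟨.H, [.add uE (.var .jj)]⟩)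

/-- The `H` gates of the layer, abstractly. [folklore] -/
def hGates (ℓ : ℕ) : List (AGate ℕ) := (List.range (clNumControls ℓ)).map fun j => ⟨.H, [ℓ + j]⟩

/-- The stream of `hadG`. [folklore] -/
theorem out_hadG (ℓ : ℕ) : hadG.out (envU ℓ) = (hGates ℓ).flatMap AGate.toks := by
  rw [hadG, GStmt.out, eval_KGE (envU_uu ℓ), hGates, List.flatMap_map]
  refine List.flatMap_congr fun j _ => ?_
  have hu : Function.update (envU ℓ) GV.jj j GV.uu = ℓ := by
    rw [Function.update_of_ne (by decide)]; exact envU_uu ℓ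
  rw [out_agateG]
  simp [AGate.map, GExpr.eval, eval_uE hu]

/-- `hadG` does not reuse loop variables, and they avoid the input variable. [folklore] -/
theorem hygiene_hadG : GV.uu ∉ hadG.loopVars ∧ hadG.noReuse = true := by
  constructor
  · decide
  · rfl

/-- **The bits of the Hadamard layer as an `FP` function of `1^ℓ`.** [cite: AroraBarak2009, §6.2 Def. 6.12] -/
theorem hadBits_mem_FP : (fun z : List Bool => Tok.render 0 (hadG.out (envU z.length))) ∈ FP :=
  GStmt.render_out_mem_FP hadG .uu hygiene_hadG.1 hygiene_hadG.2

/-- The rendered stream of `hadG` is the description of the Hadamard layer. [folklore] -/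
theorem render_out_hadG (ℓ m : ℕ) :
    Tok.render 0 (hadG.out (envU ℓ)) = (hadamardLayer ℓ (clNumControls ℓ) m).flatMap gateEnc := by
  rw [out_hadG, ← List.append_nil ((hGates ℓ).flatMap AGate.toks), render_flatMap_toks, Tok.render_nil,
    List.append_nil, hadamardLayer, coinWires, List.map_map, List.flatMap_map, hGates, List.flatMap_map,
    ← List.map_coe_finRange_eq_range, List.flatMap_map]
  refine List.flatMap_congr fun j _ => ?_
  simp [gateEnc_hOn, val_coinWire, AGate.bits, symCode, symArity]

/-! #### The phase layer -/

/-- The three `S` gates of a sine wire, abstractly. [folklore] -/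
def sss (w : ℕ) : List (AGate ℕ) := [⟨.S, [w]⟩, ⟨.S, [w]⟩, ⟨.S, [w]⟩]

/-- **Generator of the phase layer**: for each (trial, slot, level) triple the cosine window is
skipped and every wire of the sine window carries `S³`. [cite: Kitaev1995, §3 Remark 8; AroraBarak2009, §6.2] -/
def phaseG : GS :=
  .loop .tt PPGE (.loop .jj BGE (seqs [agateG ⟨.S, [sWireGE]⟩, agateG ⟨.S, [sWireGE]⟩, agateG ⟨.S, [sWireGE]⟩]))

/-- The `S` gates of the layer in the order of the generator, abstractly. [folklore] -/
def sGates (ℓ : ℕ) : List (AGate ℕ) :=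
  (List.range (clTrials ℓ * (ℓ * clLevels ℓ))).flatMap fun pp => (List.range (clBlockSize ℓ)).flatMap fun i =>
    sss (ℓ + ((2 * pp + 1) * clBlockSize ℓ + i))

/-- The stream of `phaseG`. [folklore] -/
theorem out_phaseG (ℓ : ℕ) : phaseG.out (envU ℓ) = (sGates ℓ).flatMap AGate.toks := by
  rw [phaseG, GStmt.out, eval_PPGE (envU_uu ℓ), sGates, List.flatMap_assoc]
  refine List.flatMap_congr fun pp _ => ?_
  have hu : Function.update (envU ℓ) GV.tt pp GV.uu = ℓ := by
    rw [Function.update_of_ne (by decide)]; exact envU_uu ℓ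
  rw [GStmt.out, eval_BGE hu, List.flatMap_assoc]
  refine List.flatMap_congr fun i _ => ?_
  have hu' : Function.update (Function.update (envU ℓ) GV.tt pp) GV.jj i GV.uu = ℓ := by
    rw [Function.update_of_ne (by decide)]; exact hu
  have hw : sWireGE.eval (Function.update (Function.update (envU ℓ) GV.tt pp) GV.jj i) =
      ℓ + ((2 * pp + 1) * clBlockSize ℓ + i) := by
    rw [eval_sWireGE hu', Function.update_self, Function.update_of_ne (by decide), Function.update_self]
  simp [sss, AGate.map, hw]

/-- `phaseG` does not reuse loop variables, and they avoid the input variable. [folklore] -/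
theorem hygiene_phaseG : GV.uu ∉ phaseG.loopVars ∧ phaseG.noReuse = true := by
  constructor
  · decide
  · rfl

/-- **The bits of the phase layer as an `FP` function of `1^ℓ`.** [cite: AroraBarak2009, §6.2 Def. 6.12] -/
theorem phaseBits_mem_FP : (fun z : List Bool => Tok.render 0 (phaseG.out (envU z.length))) ∈ FP :=
  GStmt.render_out_mem_FP phaseG .uu hygiene_phaseG.1 hygiene_phaseG.2

/-- The type of a control as arithmetic of its index: a sine test iff `(j / B) mod 2 = 1`. [folklore] -/
theorem clTypeOf_eq (ℓ : ℕ) (j : Fin (clNumControls ℓ)) :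
    clTypeOf ℓ j = decide ((j : ℕ) / clBlockSize ℓ % 2 = 1) := by
  obtain ⟨⟨t, i, l, σ, r⟩, rfl⟩ := (clLayout ℓ).symm.surjective j
  rw [clTypeOf, Equiv.apply_symm_apply, val_clLayout_symm, clOff]
  have hB : 0 < clBlockSize ℓ := clBlockSize_pos ℓ
  have hdiv : (((↑t * clSlots ℓ + ↑i) * clLevels ℓ + ↑l) * (2 * clBlockSize ℓ) + σ.toNat * clBlockSize ℓ + ↑r) / clBlockSize ℓ =
      ((↑t * clSlots ℓ + ↑i) * clLevels ℓ + ↑l) * 2 + σ.toNat := by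
    rw [show ((↑t * clSlots ℓ + ↑i) * clLevels ℓ + ↑l) * (2 * clBlockSize ℓ) + σ.toNat * clBlockSize ℓ + (r : ℕ) =
      ↑r + (((↑t * clSlots ℓ + ↑i) * clLevels ℓ + ↑l) * 2 + σ.toNat) * clBlockSize ℓ by ring,
      Nat.add_mul_div_right _ _ hB, Nat.div_eq_of_lt r.isLt, Nat.zero_add]
  rw [hdiv]
  cases σ <;> simp

/-- The phase layer, control by control, as arithmetic of the index. [folklore] -/
theorem flatMap_gateEnc_phaseLayer (ℓ m : ℕ) :
    (Kitaev1995.phaseLayer ℓ (clNumControls ℓ) m (clTypeOf ℓ)).flatMap gateEnc =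
      (List.range (clNumControls ℓ)).flatMap fun j =>
        if j / clBlockSize ℓ % 2 = 1 then (sss (ℓ + j)).flatMap AGate.bits else [] := by
  rw [Kitaev1995.phaseLayer, phaseLayerL, List.flatMap_assoc, ← List.map_coe_finRange_eq_range, List.flatMap_map]
  refine List.flatMap_congr fun j _ => ?_
  rw [clTypeOf_eq]
  by_cases h : (j : ℕ) / clBlockSize ℓ % 2 = 1
  · rw [decide_eq_true h, if_pos rfl, if_pos h]
    simp [sss, gateEnc_sOn, val_coinWire, AGate.bits, symCode, symArity]
  · rw [decide_eq_false h, if_neg h]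
    simp

/-- **The rendered stream of `phaseG` is the description of the phase layer** of the class-group
layout. [cite: Kitaev1995, §3 Remark 8] -/
theorem render_out_phaseG (ℓ m : ℕ) :
    Tok.render 0 (phaseG.out (envU ℓ)) = (Kitaev1995.phaseLayer ℓ (clNumControls ℓ) m (clTypeOf ℓ)).flatMap gateEnc := by
  rw [out_phaseG, ← List.append_nil ((sGates ℓ).flatMap AGate.toks), render_flatMap_toks, Tok.render_nil,
    List.append_nil, flatMap_gateEnc_phaseLayer, sGates, List.flatMap_assoc]
  have hB : 0 < clBlockSize ℓ := clBlockSize_pos ℓ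
  have hK : clNumControls ℓ = clTrials ℓ * (ℓ * clLevels ℓ) * (clBlockSize ℓ + clBlockSize ℓ) := by
    unfold clNumControls clSlots; ring
  have hR := ModExpBlock.flatMap_range_mul (clTrials ℓ * (ℓ * clLevels ℓ)) (clBlockSize ℓ + clBlockSize ℓ)
    (fun j => if j / clBlockSize ℓ % 2 = 1 then (sss (ℓ + j)).flatMap AGate.bits else [])
  rw [hK, hR]
  refine List.flatMap_congr fun pp _ => ?_
  rw [List.flatMap_assoc, flatMap_range_add]
  -- the cosine window contributes nothing
  have h0 : ((List.range (clBlockSize ℓ)).flatMap fun r =>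
      if (pp * (clBlockSize ℓ + clBlockSize ℓ) + r) / clBlockSize ℓ % 2 = 1 then
        (sss (ℓ + (pp * (clBlockSize ℓ + clBlockSize ℓ) + r))).flatMap AGate.bits else []) = [] := by
    rw [List.flatMap_eq_nil_iff]
    intro r hr
    rw [List.mem_range] at hr
    rw [if_neg]
    rw [show pp * (clBlockSize ℓ + clBlockSize ℓ) + r = r + 2 * pp * clBlockSize ℓ by ring,
      Nat.add_mul_div_right _ _ hB, Nat.div_eq_of_lt hr]
    omega
  rw [h0, List.nil_append]
  refine List.flatMap_congr fun i hi => ?_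
  rw [List.mem_range] at hi
  rw [if_pos]
  · have e : pp * (clBlockSize ℓ + clBlockSize ℓ) + (clBlockSize ℓ + i) = (2 * pp + 1) * clBlockSize ℓ + i := by ring
    rw [e]
  · rw [show pp * (clBlockSize ℓ + clBlockSize ℓ) + (clBlockSize ℓ + i) = i + (2 * pp + 1) * clBlockSize ℓ by ring,
      Nat.add_mul_div_right _ _ hB, Nat.div_eq_of_lt hi]
    omega

/-! #### The clean block -/

/-- **The bits of the clean block as an `FP` function of `1^ℓ`** (`CleanBlockDesc`, no suffix).
[cite: AroraBarak2009, §6.2 Def. 6.12 and Remark 6.7] -/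
theorem blockBits_mem_FP : (fun z : List Bool => (opsNC z.length).flatMap opBits) ∈ FP := by
  have h := flatMap_opBits_cleanOps_mem_FP (e := eC) (M := MC) NGE NGE [] inUU_NGE (by simp) (fun _ => []) (fun u => rfl)
    (fun u => by rw [List.length_nil, Nat.add_zero])
  refine (congrArg (· ∈ FP) (funext fun z => ?_)).mp h
  rw [opsNC, eval_NGE (envU_uu z.length)]

/-- The description of the compiled block is the concatenation of the `opBits`. [folklore] -/
theorem flatMap_gateEnc_VC (ℓ : ℕ) : (VC ℓ).gates.flatMap gateEnc = (opsNC ℓ).flatMap opBits :=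
  flatMap_gateEnc_revCompile_toRevList (layoutN_pos ℓ) (opsNC ℓ) (opsN_lt ℓ) (opsFin_wf ℓ)

/-! #### The description function -/

/-- The ancilla count `clNumControls ℓ + mWC ℓ = width (dataNC ℓ) - ℓ`, in unary, from `z`
(`|z| = ℓ`). [folklore] -/
def ancF : List Bool → List Bool := dropFn ∘ fanoutFn (fun z => z) (polyFn ((widthPoly eC MC).comp lenPoly))

/-- `ancF ∈ FP`. [folklore] -/
theorem ancF_mem_FP : ancF ∈ FP := comp_mem_FP dropFn_mem_FP (fanoutFn_mem_FP (PolyTimeComputable.id _) (polyFn_mem_FP _))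

/-- Value of `ancF`. [folklore] -/
theorem ancF_apply (z : List Bool) : ancF z = unaryEncodeNat (clNumControls z.length + mWC z.length) := by
  rw [ancF, Function.comp_apply, fanoutFn_apply, dropFn_boolPair, polyFn_apply, Polynomial.eval_comp, lenPoly_eval,
    eval_widthPoly, Complexity.unaryEncodeNat_eq_replicate, List.drop_replicate]
  congr 1
  have := dataN_le_totN z.length
  unfold mWC totNC dataNC at *
  omega

/-- The gate bits: Hadamard layer, block, phase layer, Hadamard layer. [folklore] -/
def gatesF (z : List Bool) : List Bool :=
  Tok.render 0 (hadG.out (envU z.length)) ++ ((opsNC z.length).flatMap opBits ++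
    (Tok.render 0 (phaseG.out (envU z.length)) ++ Tok.render 0 (hadG.out (envU z.length))))

/-- `gatesF ∈ FP`. [folklore] -/
theorem gatesF_mem_FP : gatesF ∈ FP :=
  Complexity.append_mem_FP hadBits_mem_FP (Complexity.append_mem_FP blockBits_mem_FP
    (Complexity.append_mem_FP phaseBits_mem_FP hadBits_mem_FP))

/-- **The description function of the family as a brick.** [folklore] -/
def descF : List Bool → List Bool := fanoutFn lenBinF (fanoutFn ancF gatesF)

/-- `descF ∈ FP`. [folklore] -/
theorem descF_mem_FP : descF ∈ FP := fanoutFn_mem_FP lenBinF_mem_FP (fanoutFn_mem_FP ancF_mem_FP gatesF_mem_FP)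

/-- **`descF` is the description function of `kitaevClFamily mWC VC`.** [cite: AroraBarak2009, §6.2] -/
theorem descF_eq : (kitaevClFamily mWC VC).descFn = descF := by
  funext z
  rw [QCircuitFamily.descFn_eq, descF, fanoutFn_apply, fanoutFn_apply, lenBinF_apply, ancF_apply]
  congr 2
  show QCircuit.encode (kitaevCircuit (VC z.length) (clTypeOf z.length)) = gatesF z
  rw [kitaevCircuit, encode_eq_flatMap, List.flatMap_append, List.flatMap_append, List.flatMap_append, gatesF,
    render_out_hadG z.length (mWC z.length), render_out_phaseG z.length (mWC z.length), flatMap_gateEnc_VC]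
  simp only [List.append_assoc]

/-- **Kitaev's class-group family around the block `VC` is polynomial-time uniform**: the description
— header, the Hadamard layer (`hadG`), the clean block (`CleanBlockDesc`), the phase layer
(`phaseG`), the Hadamard layer — is printed from `1^ℓ` in polynomial time ("our procedure is
uniform … constructed in time `poly(k+n)` by a classical Turing machine").
[cite: Kitaev1995, §4 p.15 (uniformity); AroraBarak2009, §6.2 Def. 6.12] -/
theorem kitaevClFamily_isUniform : (kitaevClFamily mWC VC).IsUniform := by
  rw [QCircuitFamily.isUniform_iff_descFn_mem_FP, descF_eq]
  exact descF_mem_FP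

end ClUniform

end Literature.Computability.Cryptography.Hallgren2005

end
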